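import Summits.CriticalPhenomena.SAWScalingLimit.Theses.SAWChargeContinuation
import Summits.CriticalPhenomena.SAWScalingLimit.Theorems.SAWChargeContinuationAssemblyTarget

/-!
# `SAWChargeContinuation.Assembly` (stmt-CriticalPhenomena-4930) — proved

Route `SAWChargeContinuation` of `CriticalPhenomena/SAWScalingLimit`, assembly item

  `Assembly : RestrictionIdentification → AvoidanceOfLimit → VitaliTransport → WindowAvoidanceLaw →
    ChargeAnalyticity → EventualTight → SubseqSimple → SAWScalingLimit`.

This is pure logic on top of the support item `AssemblyTarget`
(`RestrictionIdentification → AvoidanceOfLimit → Target → SAWScalingLimit`), which is PROVED in the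
tree (`chargeContinuation_assemblyTarget_proof`, file `SAWChargeContinuationAssemblyTarget.lean`:
Prokhorov on the Polish space `CurveClass ℂ`, identification of subsequential limits by the
restriction formula, uniqueness of the chordal SLE_{8/3} law).

## Proof

`VitaliTransport : WindowAvoidanceLaw → ChargeAnalyticity → SAWAvoidanceLaw` turns the two cruxes
`(P) WindowAvoidanceLaw` and `(U) ChargeAnalyticity` into `(A0) SAWAvoidanceLaw`; together with
`(T) EventualTight` and `(S) SubseqSimple` this is the route's `Target`, which unfolds
(zeta-reduction of the inlined lets `hull` / `pb` / `carrier` of the route file) to the conjunction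
`SAWAvoidanceLaw ∧ EventualTight ∧ SubseqSimple`; `AssemblyTarget` then yields the sub-problem
statement `SAWScalingLimit`. No analytic or probabilistic input enters at this level.

## References

* G. F. Lawler, O. Schramm, W. Werner, *Conformal restriction: the chordal case*, J. Amer. Math.
  Soc. 16 (2003), Thm. 6.1 (the SLE_{8/3} restriction formula behind `Target`).
* M. J. Kozdron, G. F. Lawler, *The configurational measure on mutually avoiding SLE paths* (2007),
  §6 (the λ-SAW family behind the cruxes `WindowAvoidanceLaw` / `ChargeAnalyticity`).
-/

noncomputable section

open Summit.CriticalPhenomena.SAWScalingLimit.Theses.SAWChargeContinuation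

namespace Summit.CriticalPhenomena.SAWScalingLimit.Theorems

/-- **`SAWChargeContinuation.Assembly` (stmt-CriticalPhenomena-4930) holds**:
`RestrictionIdentification → AvoidanceOfLimit → VitaliTransport → WindowAvoidanceLaw →
ChargeAnalyticity → EventualTight → SubseqSimple → SAWScalingLimit`. `VitaliTransport` applied to
the cruxes `WindowAvoidanceLaw` and `ChargeAnalyticity` gives `SAWAvoidanceLaw`; with `EventualTight`
and `SubseqSimple` this is `Target = SAWAvoidanceLaw ∧ EventualTight ∧ SubseqSimple` (the lets
`hull`, `pb`, `carrier` of the route file are definitionally transparent, so the anonymous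
constructor builds it); the proved support item `AssemblyTarget`
(`chargeContinuation_assemblyTarget_proof`) concludes `SAWScalingLimit`. -/
theorem chargeContinuation_assembly_proof :
    Summit.CriticalPhenomena.SAWScalingLimit.Theses.SAWChargeContinuation.Assembly := by
  unfold Summit.CriticalPhenomena.SAWScalingLimit.Theses.SAWChargeContinuation.Assembly
  intro hRI hAL hVT hP hU hT hS
  exact chargeContinuation_assemblyTarget_proof hRI hAL ⟨hVT hP hU, hT, hS⟩

end Summit.CriticalPhenomena.SAWScalingLimit.Theorems

end
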